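import Summits.HodgeConjecture.HodgeConjecture.Theorems.AnchorTransportVariationalHodgeStubDominanceForm
import Summits.HodgeConjecture.HodgeConjecture.Theorems.AnchorTransportVariationalHodgeCorrespondenceTransport
import Literature.AlgebraicGeometry.HodgeTheory.SupportedClassesPurity
import Literature.AlgebraicGeometry.HodgeTheory.HypersurfaceLefschetzProofs
import Literature.AlgebraicGeometry.HodgeTheory.FlatFamilyCycleClass
import Literature.AlgebraicGeometry.Deformation.SquareZeroExtensionObstruction
import HarnessLib

/-!
# Route AnchorTransport — `VariationalHodge` (stmt-HodgeConjecture-1076), line `polar-patch-broken-cycles`: stub `stub_carriesClassOfCycleClass`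

The registered stub S2b ("granted the flat-family cycle class, polar families carry the class"),
gen-4 short signature (FACT by name, curried reduced polar data, abstract closed patch set `P`),
proved from its hypothesis FACT (= `fulton1998_flatFamily_cycleClass_specialises`, Fulton 1998
Cor. 10.1 / Lemma 19.1.1: a flat family `𝒲 ⊆ 𝒳 ×_S V → V` whose fibre over `v₀` is `W₀ ∪ C` has a
global class `Γ` with `Γ|_{X_t}` algebraic for all `t` and `Γ|_{X_{v₀}} = c₀ w + (class on C)`,
`0 ≠ w` supported on `W₀`, `c₀ ≠ 0`). **Proof.** Move the polar datum to the fibre `X₀'` of the base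
change `g' : 𝒳 ×_S V → V` over `v₀` along `θ = fiberOverFamilyPullbackIso` (the central fibre of `𝒲`
is `θ⁻¹(W₀) ∪ θ⁻¹(P)` by the compatibility square, cancelling the monomorphism
`X₀ ↪ 𝒳`); apply FACT; by PURITY (`exists_ker_restrictCompl_le_span_of_isIrreducible`, Fulton
Lemma 19.1.1) the classes supported on the irreducible codimension-`2` set `θ⁻¹(W₀)` form a line, so
`θ^*(m A|_{X₀} - e^*u) = λ w`; the `C`-part of `Γ|_{X₀'}` is ambient (hypothesis: patch classes are
restricted from `ℙᴺ`); hence the global class `Θ = c₀ (m A' - e'^*u) - λ (Γ - e'^*u₁)` dies on `X₀'`,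
so by RIGIDITY of flat sections (`exists_isOpen_forall_map_fiberι_eq_zero`: Ehresmann + transport in
`R⁴ g'_* ℂ` over a connected Zariski neighbourhood `U` of `v₀`, Voisin II §3.1.2) it dies on `X_t`
for `t ∈ U(ℂ)`; there `c₀ m A'|_{X_t}` is a combination of `Γ|_{X_t}` (algebraic by FACT) and classes
restricted from `ℙᴺ` (algebraic by the MOVING LEMMA `map_projectiveSpace_mem_algebraicClasses`,
Voisin II Cor. 1.24), and `c₀ m ≠ 0`. References: Fulton, *Intersection Theory* (1998) §10.1,
§19.1; Voisin, *Hodge Theory II* (2003) §3.1.2, §1.2.3; SGA1 XII Prop. 2.4.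
-/

noncomputable section

-- every declaration of this problem lives in `Summit.HodgeConjecture.HodgeConjecture.…` (summit = sub-problem)
set_option linter.dupNamespace false

open CategoryTheory CategoryTheory.Limits AlgebraicGeometry TopologicalSpace
open Literature.AlgebraicGeometry.Motives Literature.AlgebraicGeometry.HodgeTheory
open Literature.AlgebraicGeometry.Deformation (conormalSheaf)
open Summit.HodgeConjecture.HodgeConjecture.Theses.AnchorTransport

namespace Summit.HodgeConjecture.HodgeConjecture.Theorems

/-- In a Noetherian topological space every point `x` has a connected open neighbourhood: the
complement `W` of the (finitely many, closed) irreducible components not containing `x`; every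
`y ∈ W` lies together with `x` in the irreducible, hence connected, set `Z(y) ∩ W`. [folklore] -/
private theorem exists_isOpen_mem_isConnected {α : Type*} [TopologicalSpace α] [NoetherianSpace α]
    (x : α) : ∃ W : Set α, IsOpen W ∧ x ∈ W ∧ IsConnected W := by
  classical
  set bad : Set (Set α) := {Z | Z ∈ irreducibleComponents α ∧ x ∉ Z} with hbad
  have hfin : bad.Finite := NoetherianSpace.finite_irreducibleComponents.subset fun Z hZ => hZ.1
  have hopen : IsOpen (⋃ Z ∈ bad, Z)ᶜ :=
    (hfin.isClosed_biUnion fun Z hZ => isClosed_of_mem_irreducibleComponents Z hZ.1).isOpen_compl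
  have hmem : ∀ y, y ∈ (⋃ Z ∈ bad, Z)ᶜ ↔ ∀ Z ∈ irreducibleComponents α, y ∈ Z → x ∈ Z := fun y => by
    simp only [Set.mem_compl_iff, Set.mem_iUnion, not_exists, exists_prop, not_and, hbad,
      Set.mem_setOf_eq]
    exact ⟨fun h Z hZ hy => by_contra fun hx => h Z ⟨hZ, hx⟩ hy, fun h Z hZ hy => hZ.2 (h Z hZ.1 hy)⟩
  have hx : x ∈ (⋃ Z ∈ bad, Z)ᶜ := (hmem x).2 fun Z _ h => h
  refine ⟨_, hopen, hx, ⟨x, hx⟩, isPreconnected_of_forall x fun y hy => ?_⟩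
  refine ⟨irreducibleComponent y ∩ (⋃ Z ∈ bad, Z)ᶜ, Set.inter_subset_right,
    ⟨(hmem y).1 hy _ (irreducibleComponent_mem_irreducibleComponents y) mem_irreducibleComponent, hx⟩,
    ⟨mem_irreducibleComponent, hy⟩, ?_⟩
  refine IsPreirreducible.isPreconnected fun u v hu hv ⟨a, ⟨haZ, haU⟩, hau⟩ ⟨b, ⟨hbZ, hbU⟩, hbv⟩ => ?_
  obtain ⟨c, hcZ, ⟨hcu, hcU⟩, hcv, -⟩ := isIrreducible_irreducibleComponent.isPreirreducible _ _
    (hu.inter hopen) (hv.inter hopen) ⟨a, haZ, hau, haU⟩ ⟨b, hbZ, hbv, hbU⟩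
  exact ⟨c, ⟨hcZ, hcU⟩, hcu, hcv⟩

/-- In a locally Noetherian scheme every point has a connected quasi-compact open neighbourhood `U`
inside an affine open `U₀` (`exists_isOpen_mem_isConnected` in the Noetherian space `U₀`). [folklore] -/
private theorem exists_opens_connectedSpace {X : Scheme} [IsLocallyNoetherian X] (x : X) :
    ∃ (U₀ U : X.Opens), IsAffineOpen U₀ ∧ U ≤ U₀ ∧ x ∈ U ∧ ConnectedSpace U ∧ CompactSpace U := by
  obtain ⟨U₀, hU₀, hx, -⟩ := exists_isAffineOpen_mem_and_subset (U := ⊤) (x := x) trivial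
  haveI : IsAffine U₀ := hU₀
  haveI : IsNoetherian (U₀ : Scheme) := {}
  haveI : NoetherianSpace (U₀ : Set X) := inferInstanceAs (NoetherianSpace (U₀ : Scheme))
  obtain ⟨W, hWo, hxW, hWc⟩ := exists_isOpen_mem_isConnected (⟨x, hx⟩ : (U₀ : Set X))
  have hset : ((U₀.ι ''ᵁ ⟨W, hWo⟩ : X.Opens) : Set X) = Subtype.val '' W := rfl
  refine ⟨U₀, U₀.ι ''ᵁ ⟨W, hWo⟩, hU₀, U₀.ι_image_le _, ⟨⟨x, hx⟩, hxW, rfl⟩, ?_, ?_⟩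
  · exact isConnected_iff_connectedSpace.1 (hset ▸ hWc.image _ continuous_subtype_val.continuousOn)
  · exact isCompact_iff_compactSpace.1 (hset ▸ (NoetherianSpace.isCompact W).image continuous_subtype_val)

/-- **Rigidity of global classes near a point of a smooth base.** For a smooth projective family
`g : 𝒳 ⟶ V` over a `ℂ`-scheme `V` smooth over `ℂ` and `v₀ ∈ V(ℂ)` there is a Zariski-open `U ∋ v₀`
such that every global class `Θ ∈ Hᵏ(𝒳(ℂ); ℂ)` with `Θ|_{𝒳_{v₀}} = 0` has `Θ|_{𝒳_t} = 0` for all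
`t ∈ U(ℂ)`: take `U` connected, quasi-compact and inside an affine open (`exists_opens_connectedSpace`;
`V` is locally Noetherian), so that `U(ℂ)` is connected (SGA1 XII 2.4,
`ComplexPoints.connectedSpace_iff_holds`), `U` is smooth of one relative dimension and separated over
`ℂ`, and apply the identity principle for flat sections `complexBetti_map_fiberι_eq_zero_of_eq_zero`
to the restricted family `𝒳 ×_V U ⟶ U`, moving restrictions across `fiberOverFamilyPullbackIso`.
[cite: VoisinHodgeII2003, §3.1.2] -/
theorem exists_isOpen_forall_map_fiberι_eq_zero {n : ℕ} {𝒳 V : SchemeOver ℂ} (g : 𝒳 ⟶ V)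
    (hg : IsSmoothProjectiveFamily g n) [AlgebraicGeometry.Smooth V.hom] (v₀ : ComplexPoints V) :
    ∃ U : Set V.left, IsOpen U ∧ v₀.pt ∈ U ∧ ∀ (k : ℕ) (Θ : complexBetti 𝒳 k),
      complexBetti.map (fiberι g v₀) k Θ = 0 →
        ∀ t : ComplexPoints V, t.pt ∈ U → complexBetti.map (fiberι g t) k Θ = 0 := by
  haveI : LocallyOfFiniteType V.hom := inferInstance
  haveI : IsLocallyNoetherian V.left := LocallyOfFiniteType.isLocallyNoetherian V.hom
  obtain ⟨U₀, U, hU₀, hUU₀, hv₀, hUc, hUk⟩ := exists_opens_connectedSpace v₀.pt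
  refine ⟨U, U.isOpen, hv₀, fun k Θ hΘ t ht => ?_⟩
  -- the restricted family over the connected open `U`
  set j := openSubschemeOverι V U
  haveI : IsOpenImmersion j.left := inferInstanceAs (IsOpenImmersion U.ι)
  haveI : ConnectedSpace (openSubschemeOver V U).left := hUc
  haveI : CompactSpace (openSubschemeOver V U).left := hUk
  haveI : AlgebraicGeometry.Smooth (openSubschemeOver V U).hom :=
    inferInstanceAs (AlgebraicGeometry.Smooth (U.ι ≫ V.hom))
  haveI : LocallyOfFiniteType (openSubschemeOver V U).hom := inferInstance
  haveI : IsSeparated (openSubschemeOver V U).hom := by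
    change IsSeparated (U.ι ≫ V.hom)
    rw [← V.left.homOfLE_ι hUU₀, Category.assoc]
    haveI : IsAffine U₀ := hU₀
    haveI : IsAffineHom (U₀.ι ≫ V.hom) := inferInstance
    infer_instance
  haveI : ConnectedSpace (ComplexPoints (openSubschemeOver V U)) :=
    (ComplexPoints.connectedSpace_iff_holds _).2 ‹_›
  obtain ⟨m, hm⟩ := exists_smoothOfRelativeDimension_of_connectedSpace_complexPoints (openSubschemeOver V U)
  haveI := hm
  haveI := (hg.familyPullback_snd j).smoothOfRelativeDimension
  haveI := (hg.familyPullback_snd j).isProper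
  -- lift the two points to `U`
  have hrange : ∀ s : ComplexPoints V, s.pt ∈ U → s.pt ∈ j.left.opensRange := fun s hs => by
    change s.pt ∈ U.ι.opensRange
    rwa [Scheme.Opens.opensRange_ι]
  obtain ⟨v₀', rfl⟩ : ∃ v', AlgPoints.map j v' = v₀ :=
    ⟨_, AlgPoints.map_liftOfMemOpensRange j v₀ (hrange v₀ hv₀)⟩
  obtain ⟨t', rfl⟩ : ∃ t', AlgPoints.map j t' = t :=
    ⟨_, AlgPoints.map_liftOfMemOpensRange j t (hrange t ht)⟩
  have h0 : complexBetti.map (fiberι (familyPullback.snd g j) v₀') k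
      (complexBetti.map (familyPullback.fst g j) k Θ) = 0 := by
    rw [map_fiberι_familyPullback, hΘ, map_zero]
  have h1 := complexBetti_map_fiberι_eq_zero_of_eq_zero (familyPullback.snd g j) n m k _ v₀' t' h0
  rw [map_fiberι_familyPullback] at h1
  exact (complexBetti.bijective_map_of_iso (fiberOverFamilyPullbackIso g j t') k).1
    (by rw [h1, map_zero])

/-- Linear algebra of the last step: if `c₀ • (m • a - b) - λ • (c - d) = 0` with `c₀ m ≠ 0` and
`b, c, d` in a subspace `p`, then `a ∈ p`. [folklore] -/
private theorem mem_of_smul_sub_eq_zero {M : Type*} [AddCommGroup M] [Module ℂ M] (p : Submodule ℂ M)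
    {a b c d : M} {c₀ m lam : ℂ} (hc₀ : c₀ ≠ 0) (hm : m ≠ 0)
    (h : c₀ • (m • a - b) - lam • (c - d) = 0) (hb : b ∈ p) (hc : c ∈ p) (hd : d ∈ p) : a ∈ p := by
  refine (p.smul_mem_iff (mul_ne_zero hc₀ hm)).1 ?_
  rw [show (c₀ * m) • a = (c₀ • (m • a - b) - lam • (c - d)) + (c₀ • b + lam • c - lam • d) by
    module, h, zero_add]
  exact p.sub_mem (p.add_mem (p.smul_mem _ hb) (p.smul_mem _ hc)) (p.smul_mem _ hd)

/-- **Stub `stub_carriesClassOfCycleClass` (S2b) of the line `polar-patch-broken-cycles`.** Granted the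
flat-family cycle class with non-zero coefficient on `W₀` (hypothesis FACT, Fulton 1998 Cor. 10.1 and
Lemma 19.1.1), a polar family through the broken cycle `W₀ ∪ (polar patches)` carrying
`m A|_{X₀} - e^* u` on `W₀` forces `A|_{𝒳_{π t'}}` to be algebraic for all complex points `t'` of a
Zariski neighbourhood of `v₀` in `V`: purity on `W₀`, ambient patches, rigidity of the flat section
`Θ` near `v₀`, and the moving lemma for classes restricted from `ℙᴺ` (module docstring).
[cite: Fulton1998, §19.1 Lemma 19.1.1 and Cor. 10.1] [cite: VoisinHodgeII2003, §3.1.2 and §1.2.3 Cor. 1.24] -/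
theorem stub_carriesClassOfCycleClass :
    fulton1998_flatFamily_cycleClass_specialises →
    ∀ ⦃𝒳 S : SchemeOver ℂ⦄ (f : 𝒳 ⟶ S), IsSmoothProjectiveFamily f 4 → IsQuasiProjectiveOver 𝒳 →
      IrreducibleSpace S.left → IsAffine S.left → AlgebraicGeometry.Smooth S.hom →
      ∀ (A : complexBetti 𝒳 (2 * 2)) (V : SchemeOver ℂ) (π : V ⟶ S), AlgebraicGeometry.Smooth π.left →
      ∀ (v₀ : ComplexPoints V) (N : ℕ) (e : 𝒳 ⟶ projectiveSpace N ℂ)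
        (W₀ : Scheme) (i₀ : W₀ ⟶ (fiberOver f (AlgPoints.map π v₀)).left), IsClosedImmersion i₀ → IsIntegral W₀ →
        (∀ w : W₀, (2 : ℕ∞) ≤ Order.coheight (i₀.base w)) → (∃ w : W₀, Order.coheight (i₀.base w) = 2) →
      ∀ (m : ℚ), m ≠ 0 → ∀ (u : complexBetti (projectiveSpace N ℂ) (2 * 2)),
        (m : ℂ) • complexBetti.map (fiberι f (AlgPoints.map π v₀)) (2 * 2) A -
            complexBetti.map (fiberι f (AlgPoints.map π v₀) ≫ e) (2 * 2) u ∈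
          classesSupportedOn (fiberOver f (AlgPoints.map π v₀)) (Set.range i₀.base) (2 * 2) →
      ∀ (P : Set (fiberOver f (AlgPoints.map π v₀)).left), IsClosed P → (∀ x ∈ P, (2 : ℕ∞) ≤ Order.coheight x) →
        (∃ w : W₀, i₀.base w ∉ P) →
        classesSupportedOn (fiberOver f (AlgPoints.map π v₀)) P (2 * 2) ≤
          LinearMap.range (complexBetti.map (fiberι f (AlgPoints.map π v₀) ≫ e) (2 * 2)).hom →
      ∀ (Z₀ : Scheme) (iZ : Z₀ ⟶ (fiberOver f (AlgPoints.map π v₀)).left), Set.range iZ.base = Set.range i₀.base ∪ P →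
      ∀ (𝒲 : Scheme) (ι : 𝒲 ⟶ (familyPullback f π).left), IsClosedImmersion ι →
        Flat (ι ≫ (familyPullback.snd f π).left) →
      ∀ (ε : pullback ι (fiberι (familyPullback.snd f π) v₀).left ≅ Z₀),
        pullback.fst ι (fiberι (familyPullback.snd f π) v₀).left ≫ ι ≫ (familyPullback.fst f π).left =
          ε.hom ≫ iZ ≫ (fiberι f (AlgPoints.map π v₀)).left →
      ∃ U : Set V.left, IsOpen U ∧ v₀.pt ∈ U ∧
        ∀ t' : ComplexPoints V, t'.pt ∈ U →
          complexBetti.map (fiberι f (AlgPoints.map π t')) (2 * 2) A ∈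
            algebraicClasses (fiberOver f (AlgPoints.map π t')) 2 := by
  intro hfact 𝒳 S f hf _ _ _ _ A V π _ v₀ N e W₀ i₀ hi₀ hW₀ hcoh hcoh2 m hm u hx₀ P hPc hcodP hnot hamb Z₀ iZ
    hZr 𝒲 ι hι hflat ε hcompat
  haveI := hi₀
  haveI := hW₀
  haveI : AlgebraicGeometry.Smooth V.hom := by rw [← Over.w π]; infer_instance
  have hg : IsSmoothProjectiveFamily (familyPullback.snd f π) 4 := hf.familyPullback_snd π
  -- `θ : X₀' ≅ X₀`, the fibre of the base change over `v₀` and the fibre of `f` over `π v₀`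
  set θ := fiberOverFamilyPullbackIso f π v₀ with hθdef
  have hcomp : θ.hom ≫ fiberι f (AlgPoints.map π v₀) ≫ e =
      fiberι (familyPullback.snd f π) v₀ ≫ familyPullback.fst f π ≫ e := by
    rw [← Category.assoc, hθdef, fiberOverFamilyPullbackIso_hom_fiberι, Category.assoc]
  have hhi : ∀ y, θ.hom.left.base (θ.inv.left.base y) = y := fun y => by
    rw [← Scheme.Hom.comp_apply, ← Over.comp_left, θ.inv_hom_id]; rfl
  -- the transported sets `W₀'`, `C'` on `X₀'`
  set W₀' : Set (fiberOver (familyPullback.snd f π) v₀).left := θ.hom.left.base ⁻¹' Set.range i₀.base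
    with hW₀'
  set C' : Set (fiberOver (familyPullback.snd f π) v₀).left := θ.hom.left.base ⁻¹' P with hC'
  have hW₀'c : IsClosed W₀' := i₀.isClosedEmbedding.isClosed_range.preimage θ.hom.left.continuous
  have hC'c : IsClosed C' := hPc.preimage θ.hom.left.continuous
  have hih : ∀ x, θ.inv.left.base (θ.hom.left.base x) = x := fun x => by
    rw [← Scheme.Hom.comp_apply, ← Over.comp_left, θ.hom_inv_id]; rfl
  have hW₀'i : IsIrreducible W₀' := by
    have : W₀' = (fun w => θ.inv.left.base (i₀.base w)) '' Set.univ := by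
      ext x
      simp only [hW₀', Set.mem_preimage, Set.mem_range, Set.image_univ]
      constructor
      · rintro ⟨w, hw⟩
        exact ⟨w, by rw [hw, hih]⟩
      · rintro ⟨w, rfl⟩
        exact ⟨w, (hhi _).symm⟩
    rw [this]
    exact (IrreducibleSpace.isIrreducible_univ _).image _ (by fun_prop : Continuous _).continuousOn
  -- the central fibre of the flat family is `W₀' ∪ C'`
  have hsnd : pullback.snd ι (fiberι (familyPullback.snd f π) v₀).left ≫ θ.hom.left = ε.hom ≫ iZ := by
    haveI : Subsingleton ↥((specOver ℂ ℂ).left) := inferInstanceAs (Subsingleton (PrimeSpectrum ℂ))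
    haveI : IsClosedImmersion (AlgPoints.map π v₀).left :=
      isClosedImmersion_of_comp_eq_id _ _ (ComplexPoints.toSpecHom_comp_hom (AlgPoints.map π v₀))
    haveI : Mono (fiberι f (AlgPoints.map π v₀)).left := by
      change Mono (pullback.fst f.left (AlgPoints.map π v₀).left); infer_instance
    rw [← cancel_mono (fiberι f (AlgPoints.map π v₀)).left, Category.assoc, Category.assoc,
      ← Over.comp_left, hθdef, fiberOverFamilyPullbackIso_hom_fiberι, Over.comp_left,
      ← Category.assoc, ← pullback.condition, Category.assoc]
    exact hcompat
  have hrange : Set.range (pullback.snd ι (fiberι (familyPullback.snd f π) v₀).left).base = W₀' ∪ C' := by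
    have key : ∀ z, θ.hom.left.base ((pullback.snd ι (fiberι (familyPullback.snd f π) v₀).left).base z) =
        iZ.base (ε.hom.base z) := fun z => by
      rw [← Scheme.Hom.comp_apply, hsnd, Scheme.Hom.comp_apply]
    have hpre : W₀' ∪ C' = θ.hom.left.base ⁻¹' Set.range iZ.base := by
      rw [hZr, Set.preimage_union]
    rw [hpre]
    ext x
    constructor
    · rintro ⟨z, rfl⟩
      exact ⟨ε.hom.base z, (key z).symm⟩
    · rintro ⟨z₀, hz₀⟩
      obtain ⟨z, rfl⟩ := ε.hom.surjective z₀
      exact ⟨z, by rw [← hih ((pullback.snd ι (fiberι (familyPullback.snd f π) v₀).left).base z),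
          key, hz₀, hih]⟩
  have hnot' : ¬ W₀' ⊆ C' := by
    obtain ⟨w, hw⟩ := hnot
    intro hsub
    have hmem : θ.inv.left.base (i₀.base w) ∈ W₀' := ⟨w, (hhi _).symm⟩
    have := hsub hmem
    rw [hC', Set.mem_preimage, hhi] at this
    exact hw this
  have hcoh' : ∀ z ∈ W₀' ∪ C', ((2 : ℕ) : ℕ∞) ≤ Order.coheight z := by
    intro z hz
    rw [Nat.cast_ofNat, ← coheight_left_base_eq_of_iso θ z]
    rcases hz with ⟨w, hw⟩ | hz
    · rw [← hw]; exact hcoh w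
    · exact hcodP _ hz
  have hcoh2' : ∃ z ∈ W₀', Order.coheight z = ((2 : ℕ) : ℕ∞) := by
    obtain ⟨w, hw⟩ := hcoh2
    exact ⟨θ.inv.left.base (i₀.base w), ⟨w, (hhi _).symm⟩, by
      rw [Nat.cast_ofNat, ← hw, ← coheight_left_base_eq_of_iso θ, hhi]⟩
  -- the flat-family cycle class (hypothesis FACT)
  obtain ⟨Γ, w, c₀, hΓ, hw, hw0, hc0, hΓw⟩ := hfact (p := 2) (familyPullback.snd f π) hg ‹_› 𝒲 ι hι
    hflat v₀ W₀' C' hW₀'c hW₀'i hC'c hrange hnot' hcoh' hcoh2'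
  -- purity: the classes supported on `W₀'` form a line, so `θ^* x₀ = λ • w`
  obtain ⟨τ, hτ⟩ := exists_ker_restrictCompl_le_span_of_isIrreducible (hg.isSmoothProjective v₀)
    hW₀'c hW₀'i (c := 2) (by norm_num) fun z hz => hcoh' z (Or.inl hz)
  set x₀ := (m : ℂ) • complexBetti.map (fiberι f (AlgPoints.map π v₀)) (2 * 2) A -
      complexBetti.map (fiberι f (AlgPoints.map π v₀) ≫ e) (2 * 2) u with hx₀def
  have hx₀' : complexBetti.map θ.hom (2 * 2) x₀ ∈ classesSupportedOn _ W₀' (2 * 2) :=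
    mem_classesSupportedOn_iff.2
      (complexBetti.restrictCompl_map_eq_zero θ.hom (mem_classesSupportedOn_iff.1 hx₀))
  obtain ⟨lam, hlam⟩ : ∃ lam : ℂ, complexBetti.map θ.hom (2 * 2) x₀ = lam • w := by
    obtain ⟨a, ha⟩ := Submodule.mem_span_singleton.1 (hτ hw)
    obtain ⟨b, hb⟩ := Submodule.mem_span_singleton.1 (hτ hx₀')
    have ha0 : a ≠ 0 := by
      rintro rfl
      exact hw0 (by rw [← ha, zero_smul])
    exact ⟨b / a, by rw [← hb, ← ha, smul_smul, div_mul_cancel₀ b ha0]⟩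
  -- restriction to `X₀'` of classes pulled back from `ℙᴺ` along `pr ≫ e`
  have hu' : ∀ u' : complexBetti (projectiveSpace N ℂ) (2 * 2),
      complexBetti.map (fiberι (familyPullback.snd f π) v₀) (2 * 2)
          (complexBetti.map (familyPullback.fst f π ≫ e) (2 * 2) u') =
        complexBetti.map θ.hom (2 * 2)
          (complexBetti.map (fiberι f (AlgPoints.map π v₀) ≫ e) (2 * 2) u') := fun u' => by
    change (complexBetti.map (familyPullback.fst f π ≫ e) (2 * 2) ≫
        complexBetti.map (fiberι (familyPullback.snd f π) v₀) (2 * 2)) u' =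
      (complexBetti.map (fiberι f (AlgPoints.map π v₀) ≫ e) (2 * 2) ≫ complexBetti.map θ.hom (2 * 2)) u'
    rw [← complexBetti.map_comp, ← complexBetti.map_comp, hcomp]
  -- the `C'`-part of `Γ|_{X₀'}` is ambient: `Γ|_{X₀'} - c₀ • w = (pr ≫ e)^* u₁ |_{X₀'}`
  set y := complexBetti.map (fiberι (familyPullback.snd f π) v₀) (2 * 2) Γ - c₀ • w with hydef
  have hy' : complexBetti.map θ.inv (2 * 2) y ∈ classesSupportedOn _ P (2 * 2) := by
    have h1 := complexBetti.restrictCompl_map_eq_zero θ.inv (mem_classesSupportedOn_iff.1 hΓw)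
    have hPre : θ.inv.left.base ⁻¹' C' = P := by
      ext x
      rw [hC', Set.mem_preimage, Set.mem_preimage, hhi]
    rw [hPre] at h1
    exact mem_classesSupportedOn_iff.2 h1
  obtain ⟨u₁, hu₁⟩ := hamb hy'
  have hy : y = complexBetti.map (fiberι (familyPullback.snd f π) v₀) (2 * 2)
      (complexBetti.map (familyPullback.fst f π ≫ e) (2 * 2) u₁) := by
    rw [hu']
    change y = complexBetti.map θ.hom (2 * 2)
      ((complexBetti.map (fiberι f (AlgPoints.map π v₀) ≫ e) (2 * 2)).hom u₁)
    rw [hu₁, θ.complexBetti_map_hom_map_inv]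
  -- the global class `Θ` on `𝒳 ×_S V` vanishing on `X₀'`
  set Θ : complexBetti (familyPullback f π) (2 * 2) :=
    c₀ • ((m : ℂ) • complexBetti.map (familyPullback.fst f π) (2 * 2) A -
        complexBetti.map (familyPullback.fst f π ≫ e) (2 * 2) u) -
      lam • (Γ - complexBetti.map (familyPullback.fst f π ≫ e) (2 * 2) u₁) with hΘ
  have hΘ0 : complexBetti.map (fiberι (familyPullback.snd f π) v₀) (2 * 2) Θ = 0 := by
    have h1 : complexBetti.map (fiberι (familyPullback.snd f π) v₀) (2 * 2)
        ((m : ℂ) • complexBetti.map (familyPullback.fst f π) (2 * 2) A -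
          complexBetti.map (familyPullback.fst f π ≫ e) (2 * 2) u) = lam • w := by
      rw [← hlam, map_sub, map_smul, map_fiberι_familyPullback, ← hθdef, hu', hx₀def, map_sub,
        map_smul]
    have h2 : complexBetti.map (fiberι (familyPullback.snd f π) v₀) (2 * 2)
        (Γ - complexBetti.map (familyPullback.fst f π ≫ e) (2 * 2) u₁) = c₀ • w := by
      rw [map_sub, ← hy, hydef, sub_sub_cancel]
    rw [hΘ, map_sub, map_smul, map_smul, h1, h2, smul_comm, sub_self]
  -- rigidity over a Zariski neighbourhood of `v₀`, and the conclusion fibre by fibre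
  obtain ⟨U, hU, hv₀U, hrig⟩ := exists_isOpen_forall_map_fiberι_eq_zero (familyPullback.snd f π) hg v₀
  refine ⟨U, hU, hv₀U, fun t ht => ?_⟩
  rw [← map_fiberι_familyPullback_mem_algebraicClasses_iff f π hf A t]
  have hM := hrig (2 * 2) Θ hΘ0 t ht
  rw [hΘ, map_sub, map_smul, map_smul, map_sub, map_sub, map_smul] at hM
  have hamb' : ∀ u' : complexBetti (projectiveSpace N ℂ) (2 * 2),
      complexBetti.map (fiberι (familyPullback.snd f π) t) (2 * 2)
          (complexBetti.map (familyPullback.fst f π ≫ e) (2 * 2) u') ∈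
        algebraicClasses (fiberOver (familyPullback.snd f π) t) 2 := fun u' => by
    rw [← CategoryTheory.comp_apply, ← complexBetti.map_comp]
    exact map_projectiveSpace_mem_algebraicClasses (hg.isSmoothProjective t) _ 2 u'
  exact mem_of_smul_sub_eq_zero _ hc0 (by exact_mod_cast hm) hM (hamb' u) (hΓ t) (hamb' u₁)

end Summit.HodgeConjecture.HodgeConjecture.Theorems

end
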